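import Mathlib
import Literature.NumberTheory.LFunctions.Zhang2022.Section10cProfiles
import HarnessLib

/-!
# Zhang (2022) §10c: the middle-range profile of `S_j(𝐚₁₄,𝐚₂₂)` — bounds on `[P^{0.496}, P^{0.498}]`,
# its values at `P^z` against the printed integrand, and the prefactor algebra of `Z22:§10.u049 (iii)`

Topic `Literature/NumberTheory/LFunctions/Zhang2022` (Landau–Siegel audit tree; verdict-neutral).
Y. Zhang, *Discrete mean estimates and the Landau–Siegel zero*, arXiv:2211.02515v1 (2022)
[Zhang2022LandauSiegel], §10 p. 59 (tex L3028): the middle range `P^{0.496} ≤ dr < P^{0.498}` of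
`S_j(𝐚₁₄,𝐚₂₂)`, "`(500L′(1,χ)²/log²P) Σ_{P^{0.496}≤n<P^{0.498}} |χ(n)|λ₀ⱼ(n)φ(n)⁻¹(−1 − β_j log(P^{−0.496}n))
(ι₃𝔤_{j6}(P^{0.498}/n)/0.498 + ι₄𝔤_{j7}(P^{0.5}/n)/0.5) = (500𝔞/log P)∫_{0.496}^{0.498}(−1 − πij(z − 0.496))
(ι₃𝔤𝔥_{j6}(0.498 − z)/0.498 + ι₄𝔤𝔥_{j7}(0.5 − z)/0.5)dz + o(α)`" — **an unrefereed manuscript under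
adjudication; this file proves profile bookkeeping for ONE of its displayed steps and asserts nothing
about its Theorems 1–2.** ZHANG-L discharge lane (WP10, seat zl-w10-p5), companion of
`Section10cMid1422Int` (`mid1422Int_holds`), template = sz-d34's `Section10cProfiles`/`Section10cTop1422Int`.
Theorem-only; 0 new definitions, 0 facts:

* `lamAvg_congr` — `lamAvg` depends on its profile only on the window; `log_rpow_neg_mul_eq` —
  `log(P^{−0.496}x) = −log(P^{0.496}/x)`; `midSum1422_eq` — `midSum1422 = (500L′²/log²P)·lamAvg(G)`
  for the profile `G(t) = (−1 + β_j log(P^{0.496}/t))(ι₃𝔤_{j6}(P^{0.498}/t)/0.498 + ι₄𝔤_{j7}(P^{0.5}/t)/0.5)`;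
* `midG1422_bounds` — `G` is differentiable on `[1, P]` with `‖G‖ ≤ M = O(1)`, `‖G′(t)‖ ≤ M′/t`,
  `M′ = O(α)` (`logFactor_bounds`, `Section8AbelProfiles.frakgW_div_bounds`, `mul/add/const_mul_bounds`);
* `midG1422_at_rpow` — `‖G(P^z) − (−1 − πij(z − 0.496))(ι₃𝔤𝔥_{j6}(0.498 − z)/0.498 + ι₄𝔤𝔥_{j7}(0.5 − z)/0.5)‖
  ≤ C_z(c′)𝓛⁻⁸` on `[0.496, 0.498]` (`norm_betaJ_mul_log_sub_le`, sz-d19's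
  `Section8ProfilesAtPz.profiles_six/seven`);
* `norm_K500_le` — `‖500L′(1,χ)²/log²P‖ ≤ 8000e⁹𝓛⁴/𝓛¹⁸`; `midInt1422_eq` —
  `midInt1422 = (500L′²/log²P)·c_D·log P·∫…` (`frakA_eq_cD_mul`).

## References

* Y. Zhang, arXiv:2211.02515v1 (2022), §10 p. 59; §8 pp. 48–49; §2 (2.13), (2.26), (2.31).
  [cite: Zhang2022LandauSiegel, §10 p. 59]
-/

noncomputable section

open Complex Real ComplexConjugate
open Literature.NumberTheory.LFunctions.Zhang2022.Skeleton

namespace Literature.NumberTheory.LFunctions.Zhang2022.Typed.Sec10C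

section Mid1422Profile

open Literature.NumberTheory.LFunctions.Zhang2022.Section8dStatements (ffP ghP)

/-- The weighted average `lamAvg` only sees its profile on the summation window
`⌈lo⌉ ≤ n < ⌈hi⌉`. [cite: Zhang2022LandauSiegel, §10 pp. 57–61] -/
theorem lamAvg_congr (c' : ℝ) {D : ℕ} [NeZero D] (χ : DirichletCharacter ℂ D) (j : ℕ) (lo hi : ℝ)
    {g₁ g₂ : ℕ → ℂ} (h : ∀ n ∈ Finset.Ico ⌈lo⌉₊ ⌈hi⌉₊, g₁ n = g₂ n) :
    lamAvg c' χ j lo hi g₁ = lamAvg c' χ j lo hi g₂ := by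
  unfold lamAvg
  exact Finset.sum_congr rfl fun n hn => by rw [h n hn]

/-- `log(P^{−0.496}x) = −log(P^{0.496}/x)` (as complex numbers; both sides are `log` of inverse reals).
[cite: Zhang2022LandauSiegel, §10 p. 59] -/
theorem log_rpow_neg_mul_eq (D : ℕ) (x : ℝ) :
    (Real.log (bigP D ^ (-0.496 : ℝ) * x) : ℂ) = -(Real.log (bigP D ^ (0.496 : ℝ) / x) : ℂ) := by
  have hP0 : 0 < bigP D := Real.exp_pos _
  have h : bigP D ^ (-0.496 : ℝ) * x = (bigP D ^ (0.496 : ℝ) / x)⁻¹ := by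
    rw [Real.rpow_neg hP0.le, inv_div]; ring
  rw [h, Real.log_inv]; push_cast; ring

/-- **The middle-range profile of `S_j(𝐚₁₄,𝐚₂₂)` as a function of a real variable**:
`G(t) = (−1 + β_j log(P^{0.496}/t))(ι₃𝔤_{j6}(P^{0.498}/t)/0.498 + ι₄𝔤_{j7}(P^{0.5}/t)/0.5)`, with its
bounds on `[1, P]`: differentiable, `‖G‖ ≤ (1+4π)·146(‖ι₃/0.498‖ + ‖ι₄/0.5‖)`,
`‖G′(t)‖ ≤ (4·146 + (1+4π)·449)(‖ι₃/0.498‖ + ‖ι₄/0.5‖)α/t`. [cite: Zhang2022LandauSiegel, §10 p. 59] -/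
theorem midG1422_bounds (c' : ℝ) {D : ℕ} (j : ℕ) (hα : 0 < alpha D) (hℓ : 0 ≤ ell D)
    (hc : 5 * |c'| * alpha D * ell D ≤ 1) (h496P : bigP D ^ (0.496 : ℝ) ≤ bigP D)
    (h496 : 1 ≤ bigP D ^ (0.496 : ℝ)) (h498P : bigP D ^ (0.498 : ℝ) ≤ bigP D)
    (h498 : 1 ≤ bigP D ^ (0.498 : ℝ)) (h5P : bigP D ^ (0.5 : ℝ) ≤ bigP D)
    (h5 : 1 ≤ bigP D ^ (0.5 : ℝ)) {t : ℝ} (ht1 : 1 ≤ t) (htP : t ≤ bigP D) :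
    DifferentiableAt ℝ (fun u : ℝ =>
        (-1 + 1 * (betaJ c' D j * (Real.log (bigP D ^ (0.496 : ℝ) / u) : ℂ))) *
          (iota3 / 0.498 * frakgW c' D j 6 (bigP D ^ (0.498 : ℝ) / u) +
            iota4 / 0.5 * frakgW c' D j 7 (bigP D ^ (0.5 : ℝ) / u))) t ∧
      ‖(-1 + 1 * (betaJ c' D j * (Real.log (bigP D ^ (0.496 : ℝ) / t) : ℂ))) *
          (iota3 / 0.498 * frakgW c' D j 6 (bigP D ^ (0.498 : ℝ) / t) +
            iota4 / 0.5 * frakgW c' D j 7 (bigP D ^ (0.5 : ℝ) / t))‖ ≤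
        (1 + 4 * π) * (‖iota3 / (0.498 : ℂ)‖ * 146 + ‖iota4 / (0.5 : ℂ)‖ * 146) ∧
      ‖deriv (fun u : ℝ =>
        (-1 + 1 * (betaJ c' D j * (Real.log (bigP D ^ (0.496 : ℝ) / u) : ℂ))) *
          (iota3 / 0.498 * frakgW c' D j 6 (bigP D ^ (0.498 : ℝ) / u) +
            iota4 / 0.5 * frakgW c' D j 7 (bigP D ^ (0.5 : ℝ) / u))) t‖ ≤
        (4 * alpha D * (‖iota3 / (0.498 : ℂ)‖ * 146 + ‖iota4 / (0.5 : ℂ)‖ * 146) +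
          (1 + 4 * π) * (‖iota3 / (0.498 : ℂ)‖ * (449 * alpha D) +
            ‖iota4 / (0.5 : ℂ)‖ * (449 * alpha D))) / t := by
  have hαΛ : alpha D * Real.log (bigP D) ≤ 4 := by
    have : alpha D * Real.log (bigP D) = π := by
      rw [alpha]; field_simp [(show Real.log (bigP D) ≠ 0 from by
        intro h; rw [alpha, h, div_zero] at hα; exact lt_irrefl _ hα)]
    rw [this]; linarith [Real.pi_lt_four]
  obtain ⟨d1, n1, n1'⟩ := logFactor_bounds c' j (a := -1) (s := 1) (by simp) (by simp) hα hℓ hc h496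
    h496P ht1 htP
  obtain ⟨d6, n6, n6'⟩ := Section8AbelProfiles.frakgW_div_bounds c' j 6 hα hℓ hc h498 h498P ht1 htP hαΛ
  obtain ⟨d7, n7, n7'⟩ := Section8AbelProfiles.frakgW_div_bounds c' j 7 hα hℓ hc h5 h5P ht1 htP hαΛ
  obtain ⟨e6, m6, m6'⟩ := const_mul_bounds (iota3 / (0.498 : ℂ)) d6 n6 n6'
  obtain ⟨e7, m7, m7'⟩ := const_mul_bounds (iota4 / (0.5 : ℂ)) d7 n7 n7'
  have m6'' : ‖deriv (fun u : ℝ => iota3 / 0.498 * frakgW c' D j 6 (bigP D ^ (0.498 : ℝ) / u)) t‖ ≤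
      ‖iota3 / (0.498 : ℂ)‖ * (449 * alpha D) / t := by simpa [mul_div_assoc] using m6'
  have m7'' : ‖deriv (fun u : ℝ => iota4 / 0.5 * frakgW c' D j 7 (bigP D ^ (0.5 : ℝ) / u)) t‖ ≤
      ‖iota4 / (0.5 : ℂ)‖ * (449 * alpha D) / t := by simpa [mul_div_assoc] using m7'
  obtain ⟨dS, nS, nS'⟩ := add_bounds e6 e7 m6 m7 m6'' m7''
  obtain ⟨d3, n3, n3'⟩ := Section8AbelProfiles.mul_bounds d1 dS n1 nS n1' nS' (by positivity)
  exact ⟨d3, n3, n3'⟩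

/-- **The middle-range profile of `S_j(𝐚₁₄,𝐚₂₂)` at `t = P^z`** (`0.496 ≤ z ≤ 0.498`): with the ACTUAL
shifts, `G(P^z) = (−1 + β_j(0.496 − z)log P)(ι₃𝔤_{j6}(P^{0.498−z})/0.498 + ι₄𝔤_{j7}(P^{0.5−z})/0.5)`
differs from the printed integrand `(−1 − πij(z − 0.496))(ι₃𝔤𝔥_{j6}(0.498 − z)/0.498 +
ι₄𝔤𝔥_{j7}(0.5 − z)/0.5)` by `≤ C_z(c′)·𝓛⁻⁸` (`β_j log P = jπi + O(c′α𝓛)` and sz-d19's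
`Section8ProfilesAtPz.profiles_six/seven`). [cite: Zhang2022LandauSiegel, §10 p. 59] -/
theorem midG1422_at_rpow (c' : ℝ) {D : ℕ} (hD3 : 3 ≤ D) (hΛ : 0 < Real.log (bigP D)) {j : ℕ}
    (hj : j ∈ ({1, 2, 3} : Finset ℕ)) {z : ℝ} (hz0 : 0.496 ≤ z) (hz1 : z ≤ 0.498) :
    ‖(-1 + 1 * (betaJ c' D j * (Real.log (bigP D ^ (0.496 : ℝ) / bigP D ^ z) : ℂ))) *
          (iota3 / 0.498 * frakgW c' D j 6 (bigP D ^ (0.498 : ℝ) / bigP D ^ z) +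
            iota4 / 0.5 * frakgW c' D j 7 (bigP D ^ (0.5 : ℝ) / bigP D ^ z)) -
        (-1 - π * I * j * ((z - 0.496 : ℝ) : ℂ)) *
          (iota3 / 0.498 * ghJ6 j (0.498 - z) + iota4 / 0.5 * ghJ7 j (0.5 - z))‖ ≤
      7.2 * (0.03 * π ^ 2 * |c'| * (6 + (75 * |c'| * π ^ 2 + 40 * |c'| ^ 2 * π ^ 3)) +
        1.03 * (75 * |c'| * π ^ 2 + 40 * |c'| ^ 2 * π ^ 3)) * (ell D ^ 8)⁻¹ := by
  set Cp : ℝ := 75 * |c'| * π ^ 2 + 40 * |c'| ^ 2 * π ^ 3 with hCp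
  have hCp0 : 0 ≤ Cp := by positivity
  have hP0 : 0 < bigP D := Real.exp_pos _
  have hD1 : (1 : ℝ) < D := by exact_mod_cast (by omega : 1 < D)
  have hℓ0 : 0 < ell D := Real.log_pos hD1
  have hℓ1 : 1 ≤ ell D := by
    have : (3 : ℝ) ≤ D := by exact_mod_cast hD3
    have h := Real.exp_one_lt_d9
    rw [ell, Real.le_log_iff_exp_le (by linarith)]
    linarith
  have hℓ8 : (ell D ^ 8)⁻¹ ≤ 1 := inv_le_one_of_one_le₀ (one_le_pow₀ hℓ1)
  have hℓ8pos : 0 < (ell D ^ 8)⁻¹ := by positivity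
  -- rewrite `P^{a}/P^z = P^{a − z}`, `log P^{0.496−z} = (0.496 − z) log P`
  have hr496 : bigP D ^ (0.496 : ℝ) / bigP D ^ z = bigP D ^ ((0.496 : ℝ) - z) := by
    rw [Real.rpow_sub hP0]
  have hr498 : bigP D ^ (0.498 : ℝ) / bigP D ^ z = bigP D ^ ((0.498 : ℝ) - z) := by
    rw [Real.rpow_sub hP0]
  have hr5 : bigP D ^ (0.5 : ℝ) / bigP D ^ z = bigP D ^ ((0.5 : ℝ) - z) := by
    rw [Real.rpow_sub hP0]
  have hlog : Real.log (bigP D ^ ((0.496 : ℝ) - z)) = (0.496 - z) * Real.log (bigP D) :=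
    Real.log_rpow hP0 _
  rw [hr496, hr498, hr5, hlog]
  set v : ℝ := z - 0.496 with hv
  set w6 : ℝ := 0.498 - z with hw6
  set w7 : ℝ := 0.5 - z with hw7
  have hv0 : 0 ≤ v := by rw [hv]; linarith
  have hv1 : v ≤ 0.002 := by rw [hv]; linarith
  have hw60 : 0 ≤ w6 := by rw [hw6]; linarith
  have hw61 : w6 ≤ 1 := by rw [hw6]; linarith
  have hw70 : 0 ≤ w7 := by rw [hw7]; linarith
  have hw71 : w7 ≤ 1 := by rw [hw7]; linarith
  have hw6abs : |w6| ≤ 1 := by rw [abs_of_nonneg hw60]; exact hw61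
  have hw7abs : |w7| ≤ 1 := by rw [abs_of_nonneg hw70]; exact hw71
  have h496v : (0.496 : ℝ) - z = -v := by rw [hv]; ring
  rw [h496v]
  -- the selectors and the profile comparisons at `P^w`
  obtain ⟨hsel7, hsel6, -, -⟩ := sel_eq hj
  obtain ⟨-, hg6⟩ := Section8ProfilesAtPz.profiles_six c' hD3 hj hw60 hw61
  obtain ⟨-, hg7⟩ := Section8ProfilesAtPz.profiles_seven c' hD3 hj hw70 hw71
  rw [hsel6] at hg6
  rw [hsel7] at hg7
  have hgh6 : ‖ghJ6 j w6‖ ≤ 6 := by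
    rw [← hsel6]; exact Section8SubstitutionEngine.norm_ghP_le j 6 hw6abs
  have hgh7 : ‖ghJ7 j w7‖ ≤ 6 := by
    rw [← hsel7]; exact Section8SubstitutionEngine.norm_ghP_le j 7 hw7abs
  have hgW6 : ‖frakgW c' D j 6 (bigP D ^ w6)‖ ≤ 6 + Cp := by
    calc ‖frakgW c' D j 6 (bigP D ^ w6)‖
        ≤ ‖frakgW c' D j 6 (bigP D ^ w6) - ghJ6 j w6‖ + ‖ghJ6 j w6‖ := norm_le_norm_sub_add _ _
      _ ≤ Cp * (ell D ^ 8)⁻¹ + 6 := add_le_add hg6 hgh6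
      _ ≤ Cp * 1 + 6 := by gcongr
      _ = 6 + Cp := by ring
  have hgW7 : ‖frakgW c' D j 7 (bigP D ^ w7)‖ ≤ 6 + Cp := by
    calc ‖frakgW c' D j 7 (bigP D ^ w7)‖
        ≤ ‖frakgW c' D j 7 (bigP D ^ w7) - ghJ7 j w7‖ + ‖ghJ7 j w7‖ := norm_le_norm_sub_add _ _
      _ ≤ Cp * (ell D ^ 8)⁻¹ + 6 := add_le_add hg7 hgh7
      _ ≤ Cp * 1 + 6 := by gcongr
      _ = 6 + Cp := by ring
  -- the two numerical constants `‖ι₃/0.498‖ ≤ 2.6`, `‖ι₄/0.5‖ ≤ 4.6`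
  have hι3 : ‖iota3 / (0.498 : ℂ)‖ ≤ 2.6 := by
    rw [norm_div, show (0.498 : ℂ) = ((0.498 : ℝ) : ℂ) by norm_num, Complex.norm_real,
      Real.norm_of_nonneg (by norm_num)]
    have := norm_iota34_le.1
    rw [div_le_iff₀ (by norm_num)]; linarith
  have hι4 : ‖iota4 / (0.5 : ℂ)‖ ≤ 4.6 := by
    rw [norm_div, show (0.5 : ℂ) = ((0.5 : ℝ) : ℂ) by norm_num, Complex.norm_real,
      Real.norm_of_nonneg (by norm_num)]
    have := norm_iota34_le.2
    rw [div_le_iff₀ (by norm_num)]; linarith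
  -- the bracket `B = ι₃𝔤₆/0.498 + ι₄𝔤₇/0.5` and its printed value `B₀`
  set B : ℂ := iota3 / 0.498 * frakgW c' D j 6 (bigP D ^ w6) + iota4 / 0.5 * frakgW c' D j 7 (bigP D ^ w7)
    with hB
  set B₀ : ℂ := iota3 / 0.498 * ghJ6 j w6 + iota4 / 0.5 * ghJ7 j w7 with hB₀
  have hBB₀ : ‖B - B₀‖ ≤ 7.2 * (Cp * (ell D ^ 8)⁻¹) := by
    have e : B - B₀ = iota3 / 0.498 * (frakgW c' D j 6 (bigP D ^ w6) - ghJ6 j w6) +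
        iota4 / 0.5 * (frakgW c' D j 7 (bigP D ^ w7) - ghJ7 j w7) := by
      rw [hB, hB₀]; ring
    rw [e]
    calc ‖iota3 / 0.498 * (frakgW c' D j 6 (bigP D ^ w6) - ghJ6 j w6) +
            iota4 / 0.5 * (frakgW c' D j 7 (bigP D ^ w7) - ghJ7 j w7)‖
        ≤ ‖iota3 / (0.498 : ℂ)‖ * ‖frakgW c' D j 6 (bigP D ^ w6) - ghJ6 j w6‖ +
            ‖iota4 / (0.5 : ℂ)‖ * ‖frakgW c' D j 7 (bigP D ^ w7) - ghJ7 j w7‖ := by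
          refine (norm_add_le _ _).trans ?_
          rw [norm_mul, norm_mul]
      _ ≤ 2.6 * (Cp * (ell D ^ 8)⁻¹) + 4.6 * (Cp * (ell D ^ 8)⁻¹) := by
          gcongr
      _ = 7.2 * (Cp * (ell D ^ 8)⁻¹) := by ring
  have hBn : ‖B‖ ≤ 7.2 * (6 + Cp) := by
    rw [hB]
    calc ‖iota3 / 0.498 * frakgW c' D j 6 (bigP D ^ w6) + iota4 / 0.5 * frakgW c' D j 7 (bigP D ^ w7)‖
        ≤ ‖iota3 / (0.498 : ℂ)‖ * ‖frakgW c' D j 6 (bigP D ^ w6)‖ +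
            ‖iota4 / (0.5 : ℂ)‖ * ‖frakgW c' D j 7 (bigP D ^ w7)‖ := by
          refine (norm_add_le _ _).trans ?_
          rw [norm_mul, norm_mul]
      _ ≤ 2.6 * (6 + Cp) + 4.6 * (6 + Cp) := by gcongr
      _ = 7.2 * (6 + Cp) := by ring
  -- the prefactor `A = −1 − vβ_j log P` and its printed value `A₀ = −1 − πijv`
  have hβ := norm_betaJ_mul_log_sub_le c' hΛ hj
  have hu : |c' * alpha D * ell D| = |c'| * π * (ell D ^ 8)⁻¹ := by
    rw [mul_assoc, alpha_mul_ell hℓ0, abs_mul, abs_div, abs_of_pos Real.pi_pos,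
      abs_of_pos (by positivity : 0 < ell D ^ 8)]
    ring
  have hA : ‖(-1 + 1 * (betaJ c' D j * (((-v * Real.log (bigP D) : ℝ)) : ℂ))) -
      (-1 - π * I * j * (v : ℂ))‖ ≤ 0.002 * (15 * π * |c' * alpha D * ell D|) := by
    have e : (-1 + 1 * (betaJ c' D j * (((-v * Real.log (bigP D) : ℝ)) : ℂ))) -
        (-1 - π * I * j * (v : ℂ)) =
        -(v : ℂ) * (betaJ c' D j * (Real.log (bigP D) : ℂ) - (j : ℂ) * π * I) := by
      push_cast; ring
    rw [e, norm_mul, norm_neg, Complex.norm_real, Real.norm_of_nonneg hv0]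
    exact mul_le_mul hv1 hβ (norm_nonneg _) (by norm_num)
  have hA0 : ‖(-1 : ℂ) - π * I * j * (v : ℂ)‖ ≤ 1.03 := by
    have hj3 : (j : ℝ) ≤ 3 := by
      simp only [Finset.mem_insert, Finset.mem_singleton] at hj
      rcases hj with rfl | rfl | rfl <;> norm_num
    calc ‖(-1 : ℂ) - π * I * j * (v : ℂ)‖ ≤ ‖(-1 : ℂ)‖ + ‖(π : ℂ) * I * j * (v : ℂ)‖ := norm_sub_le _ _
      _ = 1 + π * j * v := by
          rw [norm_neg, norm_one, norm_mul, norm_mul, norm_mul, Complex.norm_real, Complex.norm_I,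
            Complex.norm_natCast, Complex.norm_real, Real.norm_of_nonneg Real.pi_pos.le,
            Real.norm_of_nonneg hv0]
          ring
      _ ≤ 1 + 4 * 3 * 0.002 := by
          have h1 : π * j ≤ 4 * 3 :=
            mul_le_mul Real.pi_lt_four.le hj3 (by positivity) (by norm_num)
          have h2 : π * j * v ≤ 4 * 3 * 0.002 := mul_le_mul h1 hv1 hv0 (by norm_num)
          linarith
      _ ≤ 1.03 := by norm_num
  -- combine: `‖AB − A₀B₀‖ ≤ ‖A − A₀‖‖B‖ + ‖A₀‖‖B − B₀‖`
  have hvz : ((z - 0.496 : ℝ) : ℂ) = (v : ℂ) := by rw [hv]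
  rw [hvz]
  have key : (-1 + 1 * (betaJ c' D j * (((-v * Real.log (bigP D) : ℝ)) : ℂ))) * B -
      (-1 - π * I * j * (v : ℂ)) * B₀ =
      ((-1 + 1 * (betaJ c' D j * (((-v * Real.log (bigP D) : ℝ)) : ℂ))) - (-1 - π * I * j * (v : ℂ))) *
          B + (-1 - π * I * j * (v : ℂ)) * (B - B₀) := by ring
  rw [key]
  calc ‖((-1 + 1 * (betaJ c' D j * (((-v * Real.log (bigP D) : ℝ)) : ℂ))) -
            (-1 - π * I * j * (v : ℂ))) * B + (-1 - π * I * j * (v : ℂ)) * (B - B₀)‖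
      ≤ ‖(-1 + 1 * (betaJ c' D j * (((-v * Real.log (bigP D) : ℝ)) : ℂ))) -
            (-1 - π * I * j * (v : ℂ))‖ * ‖B‖ + ‖(-1 : ℂ) - π * I * j * (v : ℂ)‖ * ‖B - B₀‖ := by
        refine (norm_add_le _ _).trans ?_
        rw [norm_mul, norm_mul]
    _ ≤ 0.002 * (15 * π * |c' * alpha D * ell D|) * (7.2 * (6 + Cp)) +
          1.03 * (7.2 * (Cp * (ell D ^ 8)⁻¹)) := by
        gcongr
    _ = 7.2 * (0.03 * π ^ 2 * |c'| * (6 + Cp) + 1.03 * Cp) * (ell D ^ 8)⁻¹ := by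
        rw [hu]; ring

/-- The prefactor of `midSum1422`: `‖500L′(1,χ)²/log²P‖ ≤ 8000e⁹𝓛⁴/𝓛¹⁸`
(`|L′(1,χ)| ≤ 4e^{9/2}𝓛²`, `log P = 𝓛⁹`). [cite: Zhang2022LandauSiegel, §10 p. 59] -/
theorem norm_K500_le {D : ℕ} [NeZero D] (χ : DirichletCharacter ℂ D) (hℓ3 : 3 ≤ ell D)
    (hp : χ.IsPrimitive) :
    ‖500 * deriv χ.LFunction 1 ^ 2 / (Real.log (bigP D) : ℂ) ^ 2‖ ≤
      8000 * Real.exp 9 * ell D ^ 4 / ell D ^ 18 := by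
  have hΛ : Real.log (bigP D) = ell D ^ 9 := by rw [bigP, Real.log_exp]
  have hℓ0 : 0 ≤ ell D := by linarith
  have hL : ‖deriv χ.LFunction 1‖ ≤ 4 * Real.exp (9 / 2) * ell D ^ 2 := by
    have hlog : 3 ≤ Real.log D := by simpa only [ell] using hℓ3
    have hw : ‖(1 : ℂ) - 1‖ ≤ 1 / Real.log D := by
      rw [sub_self, norm_zero]; exact div_nonneg zero_le_one (by linarith)
    have h := Lemma31.norm_deriv_LFunction_le_near_one χ hlog hp hw
    have h1 : (1 + ell D) * ell D ≤ 2 * ell D ^ 2 := by nlinarith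
    calc ‖deriv χ.LFunction 1‖ ≤ 2 * Real.exp (9 / 2) * (1 + ell D) * ell D := h
      _ = 2 * Real.exp (9 / 2) * ((1 + ell D) * ell D) := by ring
      _ ≤ 2 * Real.exp (9 / 2) * (2 * ell D ^ 2) := by gcongr
      _ = 4 * Real.exp (9 / 2) * ell D ^ 2 := by ring
  rw [norm_div, norm_mul, norm_pow, norm_pow, Complex.norm_real, Real.norm_of_nonneg
    (by rw [hΛ]; positivity), hΛ]
  have h500 : ‖(500 : ℂ)‖ = 500 := by norm_num
  rw [h500]
  have hL2 : ‖deriv χ.LFunction 1‖ ^ 2 ≤ (4 * Real.exp (9 / 2) * ell D ^ 2) ^ 2 :=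
    pow_le_pow_left₀ (norm_nonneg _) hL 2
  have he : Real.exp (9 / 2) ^ 2 = Real.exp 9 := by rw [← Real.exp_nat_mul]; norm_num
  calc 500 * ‖deriv χ.LFunction 1‖ ^ 2 / (ell D ^ 9) ^ 2
      ≤ 500 * (4 * Real.exp (9 / 2) * ell D ^ 2) ^ 2 / (ell D ^ 9) ^ 2 := by gcongr
    _ = 8000 * Real.exp 9 * ell D ^ 4 / ell D ^ 18 := by rw [← he]; ring

/-- `midInt1422` over the prefactor of `midSum1422`: with `𝔞 = c_D L′(1,χ)²`,
`500𝔞/log P·∫ = (500L′²/log²P)·c_D·log P·∫`. [cite: Zhang2022LandauSiegel, §10 p. 59] -/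
theorem midInt1422_eq {D : ℕ} [NeZero D] (χ : DirichletCharacter ℂ D) (hD2 : 2 ≤ D)
    (hq : χ.IsQuadratic) (hp : χ.IsPrimitive) (hΛ : 0 < Real.log (bigP D)) (j : ℕ) :
    midInt1422 χ j = 500 * deriv χ.LFunction 1 ^ 2 / (Real.log (bigP D) : ℂ) ^ 2 *
      ((((6 / π ^ 2 * ∏ q ∈ D.primeFactors, ((q : ℝ) / (q + 1)) : ℝ)) : ℂ) *
        ((Real.log (bigP D) : ℂ) *
          ∫ z in (0.496 : ℝ)..0.498,
            (-1 - π * I * j * ((z - 0.496 : ℝ) : ℂ)) *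
              (iota3 / 0.498 * ghJ6 j (0.498 - z) + iota4 / 0.5 * ghJ7 j (0.5 - z)))) := by
  have hΛ0 : (Real.log (bigP D) : ℂ) ≠ 0 := by exact_mod_cast hΛ.ne'
  rw [midInt1422, frakA_eq_cD_mul χ hD2 hq hp]
  generalize (∫ z in (0.496 : ℝ)..0.498, (-1 - π * I * j * ((z - 0.496 : ℝ) : ℂ)) *
    (iota3 / 0.498 * ghJ6 j (0.498 - z) + iota4 / 0.5 * ghJ7 j (0.5 - z))) = J
  field_simp

/-- `midSum1422` over the profile `G` of `midG1422_bounds`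
(`−β_j log(P^{−0.496}n) = β_j log(P^{0.496}/n)`). [cite: Zhang2022LandauSiegel, §10 p. 59] -/
theorem midSum1422_eq (c' : ℝ) {D : ℕ} [NeZero D] (χ : DirichletCharacter ℂ D) (j : ℕ) :
    midSum1422 c' χ j = 500 * deriv χ.LFunction 1 ^ 2 / (Real.log (bigP D) : ℂ) ^ 2 *
      lamAvg c' χ j (bigP D ^ (0.496 : ℝ)) (bigP D ^ (0.498 : ℝ)) (fun n =>
        (-1 + 1 * (betaJ c' D j * (Real.log (bigP D ^ (0.496 : ℝ) / n) : ℂ))) *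
          (iota3 / 0.498 * frakgW c' D j 6 (bigP D ^ (0.498 : ℝ) / n) +
            iota4 / 0.5 * frakgW c' D j 7 (bigP D ^ (0.5 : ℝ) / n))) := by
  rw [midSum1422]
  congr 1
  refine lamAvg_congr c' χ j _ _ fun n _ => ?_
  rw [log_rpow_neg_mul_eq D n]
  ring

end Mid1422Profile

end Literature.NumberTheory.LFunctions.Zhang2022.Typed.Sec10C
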